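import Summits.KontsevichZagierPeriods.KontsevichZagierPeriods.Theorems.HurwitzMicroSectorsNormalFormPrincipleL2W3MoebiusMove
import Summits.KontsevichZagierPeriods.KontsevichZagierPeriods.Theorems.HyperbolicBlochOffTetraSectorKernelStubAffineOrbit

/-!
# `NormalFormPrinciple` (stmt-KontsevichZagierPeriods-3869), line `SketchIdeator1` —
# leaf `stub_boxRigidity`, layer `L2W3` (level-2 weight-3 descent): Möbius relations, package two

Pure proof file (registered sub-goal `l2w3_relations_moebius_two` of the layer `L2W3`, lead seat
c9; `--supports` the crux). Letters on `(0,1)`: `a u = 1/u`, `b u = 1/(1−u)`, `c u = 1/(1+u)`;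
a *word representation* `[Δ, x(t₀) y(t₁) z(t₂)]` on the decreasing open simplex
`Δ = {t | 0 < t₂ < t₁ < t₀ < 1} ⊆ ℝ³` is the iterated integral `∫ x y z`. The word carriers are
HYPOTHESES (representations on `Δ` with the letters written out); nothing else is assumed.

The MÖBIUS INVOLUTION `σ(u) = (1 − u)/(1 + u)` on all three coordinates with order reversal is ONE
change of variables of the Kontsevich–Zagier calculus (rule (2); the landed generic move
`l2w3_moebius_move`): it replaces the word `x y z` by the pulled-back integrand
`(z∘σ·J)(t₀) · (y∘σ·J)(t₁) · (x∘σ·J)(t₂)`, `J(u) = 2/(1+u)²`, and on `(0,1)` the pulled-back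
letters are `a ↦ b + c`, `b ↦ a − c`, `c ↦ c` (`l2o_pull_a`, `l2o_pull_b`, `l2o_pull_c`).
Expanding the product by integrand additivity (rule (1b): `KZ.integrandAddRel`, resp. its
iterated `ℤ`-linear form `aff_orbit_of_sub_sum_zsmul_mem_relations`) gives the three relations of
this package:

* (rel6) word `a c c`: `N = c(t₀)·c(t₁)·(b + c)(t₂)`, whence `[CCB] + [CCC] − [ACC] ∈ relations`;
* (rel7) word `c a c`: `N = c(t₀)·(b + c)(t₁)·c(t₂)`, whence `[CBC] + [CCC] − [CAC] ∈ relations`;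
* (rel8) word `a b c`: `N = c(t₀)·(a − c)(t₁)·(b + c)(t₂)`, whence
  `[CAB] + [CAC] − [CCB] − [CCC] − [ABC] ∈ relations`.

Each is `([N] − [T]) − ([N] − Σ words)`, the first bracket ONE rule-(2) move, the second rule (1b).

References: M. Kontsevich, D. Zagier, *Periods* (2001), §1.1–1.2, rules (1), (2); J. Zhao,
*Multiple polylogarithm values at roots of unity*, C. R. Acad. Sci. Paris 346 (2008), §4 (the
involution `σ`). No definitions are introduced.
-/

noncomputable section

open MeasureTheory Set
open Literature.NumberTheory.Transcendental Literature.NumberTheory.Transcendental.KZ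
open Summit.KontsevichZagierPeriods.HyperbolicBloch.OffTetraSectorKernel
  (aff_orbit_of_sub_sum_zsmul_mem_relations)

namespace Summit.KontsevichZagierPeriods.HurwitzMicroSectors.NormalFormPrinciple.PiBox.M3

/-! ## The Möbius pull-backs of the letters on `(0,1)` -/

/-- Möbius pull-back of the letter `a u = 1/u`: on `(0,1)`, `a(σ u)·2/(1+u)² = b u + c u` with
`σ u = (1 − u)/(1 + u)`. [folklore] -/
theorem l2o_pull_a {u : ℝ} (hu : u ∈ Ioo (0 : ℝ) 1) :
    1 / ((1 - u) / (1 + u)) * (2 / (1 + u) ^ 2) = 1 / (1 - u) + 1 / (1 + u) := by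
  have h1 : (1 : ℝ) + u ≠ 0 := by linarith [hu.1]
  have h2 : (1 : ℝ) - u ≠ 0 := by linarith [hu.2]
  field_simp
  ring

/-- Möbius pull-back of the letter `b u = 1/(1−u)`: on `(0,1)`, `b(σ u)·2/(1+u)² = a u − c u` with
`σ u = (1 − u)/(1 + u)`. [folklore] -/
theorem l2o_pull_b {u : ℝ} (hu : u ∈ Ioo (0 : ℝ) 1) :
    1 / (1 - (1 - u) / (1 + u)) * (2 / (1 + u) ^ 2) = 1 / u - 1 / (1 + u) := by
  have h1 : (1 : ℝ) + u ≠ 0 := by linarith [hu.1]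
  have h2 : u ≠ 0 := hu.1.ne'
  have h3 : 1 - (1 - u) / (1 + u) = 2 * u / (1 + u) := by
    field_simp
    ring
  rw [h3]
  field_simp
  ring

/-- Möbius pull-back of the letter `c u = 1/(1+u)`: on `(0,1)`, `c(σ u)·2/(1+u)² = c u` with
`σ u = (1 − u)/(1 + u)` (the letter `c` is Möbius-invariant). [folklore] -/
theorem l2o_pull_c {u : ℝ} (hu : u ∈ Ioo (0 : ℝ) 1) :
    1 / (1 + (1 - u) / (1 + u)) * (2 / (1 + u) ^ 2) = 1 / (1 + u) := by
  have h1 : (1 : ℝ) + u ≠ 0 := by linarith [hu.1]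
  have h3 : 1 + (1 - u) / (1 + u) = 2 / (1 + u) := by
    field_simp
    ring
  rw [h3]
  field_simp

/-- On the decreasing open simplex every coordinate lies in `(0,1)`. [folklore] -/
theorem l2o_mem_Ioo_of_mem_simplex {t : Fin 3 → ℝ}
    (ht : t ∈ {t : Fin 3 → ℝ | 0 < t 2 ∧ t 2 < t 1 ∧ t 1 < t 0 ∧ t 0 < 1}) :
    t 0 ∈ Ioo (0 : ℝ) 1 ∧ t 1 ∈ Ioo (0 : ℝ) 1 ∧ t 2 ∈ Ioo (0 : ℝ) 1 := by
  obtain ⟨h2, h21, h10, h0⟩ := ht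
  exact ⟨⟨by linarith, h0⟩, ⟨by linarith, by linarith⟩, ⟨h2, by linarith⟩⟩

/-! ## (rel6) Möbius on the word `a c c` -/

/-- **(rel6)** Möbius on the word `a c c`: the pulled-back integrand is
`c(t₀)·c(t₁)·(b + c)(t₂) = ccb + ccc` on `Δ`, so `[CCB] + [CCC] − [ACC] ∈ relations`
(ONE rule-(2) move `l2w3_moebius_move`, then rule (1b)).
[cite: KontsevichZagier2001, §1.2 rule (2)] -/
theorem l2o_rel6 :
    ∀ (ACC : IntegralRep 3), ACC.domain = {t | 0 < t 2 ∧ t 2 < t 1 ∧ t 1 < t 0 ∧ t 0 < 1} →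
        (ACC.integrand = fun t => 1 / t 0 * (1 / (1 + t 1)) * (1 / (1 + t 2))) →
      ∀ (CCB : IntegralRep 3), CCB.domain = {t | 0 < t 2 ∧ t 2 < t 1 ∧ t 1 < t 0 ∧ t 0 < 1} →
        (CCB.integrand = fun t => 1 / (1 + t 0) * (1 / (1 + t 1)) * (1 / (1 - t 2))) →
      ∀ (CCC : IntegralRep 3), CCC.domain = {t | 0 < t 2 ∧ t 2 < t 1 ∧ t 1 < t 0 ∧ t 0 < 1} →
        (CCC.integrand = fun t => 1 / (1 + t 0) * (1 / (1 + t 1)) * (1 / (1 + t 2))) →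
        of CCB + of CCC - of ACC ∈ relations := by
  intro ACC hACCd hACCi CCB hCCBd hCCBi CCC hCCCd hCCCi
  -- ONE Möbius move on `[ACC]` (letters `x = a`, `y = c`, `z = c`)
  obtain ⟨hmove, ⟨N, hNd, hNi⟩⟩ := l2w3_moebius_move (fun u => 1 / u) (fun u => 1 / (1 + u))
    (fun u => 1 / (1 + u)) ACC hACCd (hACCi ▸ fun _ _ => rfl)
  have m1 : of N - of ACC ∈ relations := hmove N hNd (hNi ▸ fun _ _ => rfl)
  -- rule (1b): `N = ccb + ccc` on `Δ`
  have m2 : of N - of CCB - of CCC ∈ relations := by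
    refine integrandAddRel_subset_relations ⟨3, N, CCB, CCC, hCCBd.trans hNd.symm,
      hCCCd.trans hNd.symm, fun t ht => ?_, rfl⟩
    obtain ⟨h0, h1, h2⟩ := l2o_mem_Ioo_of_mem_simplex (hNd.le ht)
    simp only [Pi.add_apply, hNi, hCCBi, hCCCi]
    rw [l2o_pull_c h0, l2o_pull_c h1, l2o_pull_a h2]
    ring
  have e : of CCB + of CCC - of ACC = (of N - of ACC) - (of N - of CCB - of CCC) := by abel
  rw [e]
  exact relations.sub_mem m1 m2

/-! ## (rel7) Möbius on the word `c a c` -/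

/-- **(rel7)** Möbius on the word `c a c`: the pulled-back integrand is
`c(t₀)·(b + c)(t₁)·c(t₂) = cbc + ccc` on `Δ`, so `[CBC] + [CCC] − [CAC] ∈ relations`
(ONE rule-(2) move `l2w3_moebius_move`, then rule (1b)).
[cite: KontsevichZagier2001, §1.2 rule (2)] -/
theorem l2o_rel7 :
    ∀ (CAC : IntegralRep 3), CAC.domain = {t | 0 < t 2 ∧ t 2 < t 1 ∧ t 1 < t 0 ∧ t 0 < 1} →
        (CAC.integrand = fun t => 1 / (1 + t 0) * 1 / t 1 * (1 / (1 + t 2))) →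
      ∀ (CBC : IntegralRep 3), CBC.domain = {t | 0 < t 2 ∧ t 2 < t 1 ∧ t 1 < t 0 ∧ t 0 < 1} →
        (CBC.integrand = fun t => 1 / (1 + t 0) * (1 / (1 - t 1)) * (1 / (1 + t 2))) →
      ∀ (CCC : IntegralRep 3), CCC.domain = {t | 0 < t 2 ∧ t 2 < t 1 ∧ t 1 < t 0 ∧ t 0 < 1} →
        (CCC.integrand = fun t => 1 / (1 + t 0) * (1 / (1 + t 1)) * (1 / (1 + t 2))) →
        of CBC + of CCC - of CAC ∈ relations := by
  intro CAC hCACd hCACi CBC hCBCd hCBCi CCC hCCCd hCCCi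
  -- ONE Möbius move on `[CAC]` (letters `x = c`, `y = a`, `z = c`)
  obtain ⟨hmove, ⟨N, hNd, hNi⟩⟩ := l2w3_moebius_move (fun u => 1 / (1 + u)) (fun u => 1 / u)
    (fun u => 1 / (1 + u)) CAC hCACd (fun t _ => by simp only [hCACi]; ring)
  have m1 : of N - of CAC ∈ relations := hmove N hNd (hNi ▸ fun _ _ => rfl)
  -- rule (1b): `N = cbc + ccc` on `Δ`
  have m2 : of N - of CBC - of CCC ∈ relations := by
    refine integrandAddRel_subset_relations ⟨3, N, CBC, CCC, hCBCd.trans hNd.symm,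
      hCCCd.trans hNd.symm, fun t ht => ?_, rfl⟩
    obtain ⟨h0, h1, h2⟩ := l2o_mem_Ioo_of_mem_simplex (hNd.le ht)
    simp only [Pi.add_apply, hNi, hCBCi, hCCCi]
    rw [l2o_pull_c h0, l2o_pull_a h1, l2o_pull_c h2]
    ring
  have e : of CBC + of CCC - of CAC = (of N - of CAC) - (of N - of CBC - of CCC) := by abel
  rw [e]
  exact relations.sub_mem m1 m2

/-! ## (rel8) Möbius on the word `a b c` -/

/-- **(rel8)** Möbius on the word `a b c`: the pulled-back integrand is
`c(t₀)·(a − c)(t₁)·(b + c)(t₂) = cab + cac − ccb − ccc` on `Δ`, so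
`[CAB] + [CAC] − [CCB] − [CCC] − [ABC] ∈ relations` (ONE rule-(2) move `l2w3_moebius_move`, then
iterated rule (1b) with integer coefficients, `aff_orbit_of_sub_sum_zsmul_mem_relations`).
[cite: KontsevichZagier2001, §1.2 rule (2)] -/
theorem l2o_rel8 :
    ∀ (ABC : IntegralRep 3), ABC.domain = {t | 0 < t 2 ∧ t 2 < t 1 ∧ t 1 < t 0 ∧ t 0 < 1} →
        (ABC.integrand = fun t => 1 / t 0 * (1 / (1 - t 1)) * (1 / (1 + t 2))) →
      ∀ (CAB : IntegralRep 3), CAB.domain = {t | 0 < t 2 ∧ t 2 < t 1 ∧ t 1 < t 0 ∧ t 0 < 1} →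
        (CAB.integrand = fun t => 1 / (1 + t 0) * 1 / t 1 * (1 / (1 - t 2))) →
      ∀ (CAC : IntegralRep 3), CAC.domain = {t | 0 < t 2 ∧ t 2 < t 1 ∧ t 1 < t 0 ∧ t 0 < 1} →
        (CAC.integrand = fun t => 1 / (1 + t 0) * 1 / t 1 * (1 / (1 + t 2))) →
      ∀ (CCB : IntegralRep 3), CCB.domain = {t | 0 < t 2 ∧ t 2 < t 1 ∧ t 1 < t 0 ∧ t 0 < 1} →
        (CCB.integrand = fun t => 1 / (1 + t 0) * (1 / (1 + t 1)) * (1 / (1 - t 2))) →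
      ∀ (CCC : IntegralRep 3), CCC.domain = {t | 0 < t 2 ∧ t 2 < t 1 ∧ t 1 < t 0 ∧ t 0 < 1} →
        (CCC.integrand = fun t => 1 / (1 + t 0) * (1 / (1 + t 1)) * (1 / (1 + t 2))) →
        of CAB + of CAC - of CCB - of CCC - of ABC ∈ relations := by
  intro ABC hABCd hABCi CAB hCABd hCABi CAC hCACd hCACi CCB hCCBd hCCBi CCC hCCCd hCCCi
  -- ONE Möbius move on `[ABC]` (letters `x = a`, `y = b`, `z = c`)
  obtain ⟨hmove, ⟨N, hNd, hNi⟩⟩ := l2w3_moebius_move (fun u => 1 / u) (fun u => 1 / (1 - u))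
    (fun u => 1 / (1 + u)) ABC hABCd (hABCi ▸ fun _ _ => rfl)
  have m1 : of N - of ABC ∈ relations := hmove N hNd (hNi ▸ fun _ _ => rfl)
  -- iterated rule (1b): `N = cab + cac − ccb − ccc` on `Δ`
  have m2 : of N - ((1:ℤ) • of CAB + (1:ℤ) • of CAC + (-1:ℤ) • of CCB + (-1:ℤ) • of CCC) ∈
      relations := by
    have h := aff_orbit_of_sub_sum_zsmul_mem_relations (Finset.univ : Finset (Fin 4))
      ![CAB, CAC, CCB, CCC] ![1, 1, -1, -1] N (fun i _ => by
        fin_cases i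
        · exact hCABd.trans hNd.symm
        · exact hCACd.trans hNd.symm
        · exact hCCBd.trans hNd.symm
        · exact hCCCd.trans hNd.symm) fun t ht => ?_
    · simpa [Fin.sum_univ_four, add_assoc] using h
    obtain ⟨h0, h1, h2⟩ := l2o_mem_Ioo_of_mem_simplex (hNd.le ht)
    simp only [Fin.sum_univ_four, Matrix.cons_val_zero, Matrix.cons_val_one, Matrix.cons_val_two,
      Matrix.cons_val_three, Matrix.head_cons, Matrix.tail_cons, hNi, hCABi, hCACi, hCCBi, hCCCi]
    rw [l2o_pull_c h0, l2o_pull_b h1, l2o_pull_a h2]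
    push_cast
    ring
  have e : of CAB + of CAC - of CCB - of CCC - of ABC = (of N - of ABC) -
      (of N - ((1:ℤ) • of CAB + (1:ℤ) • of CAC + (-1:ℤ) • of CCB + (-1:ℤ) • of CCC)) := by
    simp only [one_smul, neg_smul]
    abel
  rw [e]
  exact relations.sub_mem m1 m2

/-! ## The registered sub-goal -/

/-- **Möbius relations among the level-2 weight-3 words, package two (registered sub-goal
`l2w3_relations_moebius_two` of line `SketchIdeator1`, layer `L2W3`).** On word carriers over the
decreasing open simplex `Δ = {0 < t₂ < t₁ < t₀ < 1}` (hypotheses, letters `a u = 1/u`,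
`b u = 1/(1−u)`, `c u = 1/(1+u)` written out), the Möbius involution `σ(u) = (1−u)/(1+u)` on all
coordinates with order reversal (ONE rule-(2) move each, `l2w3_moebius_move`; pull-backs
`a ↦ b + c`, `b ↦ a − c`, `c ↦ c`) followed by integrand additivity (rule (1b)) yields:
(rel6) `[CCB] + [CCC] − [ACC]`, (rel7) `[CBC] + [CCC] − [CAC]`,
(rel8) `[CAB] + [CAC] − [CCB] − [CCC] − [ABC]`, all in `KZ.relations`.
[cite: KontsevichZagier2001, §1.2 rule (2)] -/
theorem l2w3_relations_moebius_two :
    (∀ (ACC : IntegralRep 3), ACC.domain = {t | 0 < t 2 ∧ t 2 < t 1 ∧ t 1 < t 0 ∧ t 0 < 1} →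
        (ACC.integrand = fun t => 1 / t 0 * (1 / (1 + t 1)) * (1 / (1 + t 2))) →
      ∀ (CCB : IntegralRep 3), CCB.domain = {t | 0 < t 2 ∧ t 2 < t 1 ∧ t 1 < t 0 ∧ t 0 < 1} →
        (CCB.integrand = fun t => 1 / (1 + t 0) * (1 / (1 + t 1)) * (1 / (1 - t 2))) →
      ∀ (CCC : IntegralRep 3), CCC.domain = {t | 0 < t 2 ∧ t 2 < t 1 ∧ t 1 < t 0 ∧ t 0 < 1} →
        (CCC.integrand = fun t => 1 / (1 + t 0) * (1 / (1 + t 1)) * (1 / (1 + t 2))) →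
        of CCB + of CCC - of ACC ∈ relations) ∧
    (∀ (CAC : IntegralRep 3), CAC.domain = {t | 0 < t 2 ∧ t 2 < t 1 ∧ t 1 < t 0 ∧ t 0 < 1} →
        (CAC.integrand = fun t => 1 / (1 + t 0) * 1 / t 1 * (1 / (1 + t 2))) →
      ∀ (CBC : IntegralRep 3), CBC.domain = {t | 0 < t 2 ∧ t 2 < t 1 ∧ t 1 < t 0 ∧ t 0 < 1} →
        (CBC.integrand = fun t => 1 / (1 + t 0) * (1 / (1 - t 1)) * (1 / (1 + t 2))) →
      ∀ (CCC : IntegralRep 3), CCC.domain = {t | 0 < t 2 ∧ t 2 < t 1 ∧ t 1 < t 0 ∧ t 0 < 1} →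
        (CCC.integrand = fun t => 1 / (1 + t 0) * (1 / (1 + t 1)) * (1 / (1 + t 2))) →
        of CBC + of CCC - of CAC ∈ relations) ∧
    (∀ (ABC : IntegralRep 3), ABC.domain = {t | 0 < t 2 ∧ t 2 < t 1 ∧ t 1 < t 0 ∧ t 0 < 1} →
        (ABC.integrand = fun t => 1 / t 0 * (1 / (1 - t 1)) * (1 / (1 + t 2))) →
      ∀ (CAB : IntegralRep 3), CAB.domain = {t | 0 < t 2 ∧ t 2 < t 1 ∧ t 1 < t 0 ∧ t 0 < 1} →
        (CAB.integrand = fun t => 1 / (1 + t 0) * 1 / t 1 * (1 / (1 - t 2))) →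
      ∀ (CAC : IntegralRep 3), CAC.domain = {t | 0 < t 2 ∧ t 2 < t 1 ∧ t 1 < t 0 ∧ t 0 < 1} →
        (CAC.integrand = fun t => 1 / (1 + t 0) * 1 / t 1 * (1 / (1 + t 2))) →
      ∀ (CCB : IntegralRep 3), CCB.domain = {t | 0 < t 2 ∧ t 2 < t 1 ∧ t 1 < t 0 ∧ t 0 < 1} →
        (CCB.integrand = fun t => 1 / (1 + t 0) * (1 / (1 + t 1)) * (1 / (1 - t 2))) →
      ∀ (CCC : IntegralRep 3), CCC.domain = {t | 0 < t 2 ∧ t 2 < t 1 ∧ t 1 < t 0 ∧ t 0 < 1} →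
        (CCC.integrand = fun t => 1 / (1 + t 0) * (1 / (1 + t 1)) * (1 / (1 + t 2))) →
        of CAB + of CAC - of CCB - of CCC - of ABC ∈ relations) :=
  ⟨l2o_rel6, l2o_rel7, l2o_rel8⟩

end Summit.KontsevichZagierPeriods.HurwitzMicroSectors.NormalFormPrinciple.PiBox.M3
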